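import Mathlib.Analysis.Complex.Basic
import Mathlib.LinearAlgebra.Matrix.ConjTranspose
import Literature.Computability.AlgebraicComplexity.LieGroupTPPConstructions
import HarnessLib

/-!
# BCGPU 2023, Remark 4.11 (complex case): three conjugates of `U(n)` in `GL(n,ℂ)` satisfy the `K`-TPP, `K` = diagonal unitary — typed and proved

Topic `Literature/Computability/AlgebraicComplexity`; sequel to `LieGroupTPPConstructions.lean`
(Blasiak–Cohn–Grochow–Pratt–Umans 2023, §4), whose module docstring lists "Rem. 4.11 (the
`GL(n,ℂ)`/`U(n)` and `GL(n,ℍ)`/`Sp(n)` variants of Thm. 4.10): prose only".  This file types the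
COMPLEX case of the remark and proves it by the argument the remark indicates (the printed proof of
Thm. 4.10 with transpose replaced by conjugate transpose and squares by squared moduli).

Source, verbatim (J. Blasiak, H. Cohn, J. A. Grochow, K. Pratt, C. Umans, *Matrix multiplication via
matrix groups*, ITCS 2023, arXiv:2204.03826 [BlasiakCohnGrochowPrattUmans2023], p. 11 of the held
text `paper:arxiv-2204.03826`, immediately after the proof of Thm. 4.10 "There are three conjugates of
`O(n,ℝ)` inside of `GL(n,ℝ)` satisfying the `K`-triple product property, where `K` is the subgroup of
diagonal matrices with `±1` entries on the diagonal"):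

> "Remark 4.11. This theorem holds when we replace `G` with `GL(n,ℂ)` (resp., `GL(n,ℍ)`), `H` with
> `U(n,ℂ)` (resp., `Sp(n)`), and `K` with the group of diagonal matrices with unit complex (resp.,
> quaternionic) numbers on the diagonal. This follows from a similar argument, where one replaces
> transpose with conjugate transpose and uses the positivity of the complex/quaternionic norm. The
> corresponding dimensions are shown in Table 1."

## Content

* `unitaryGL n` — `U(n) = {g ∈ GL(n,ℂ) : gᴴ g = 1}`; `unitDiagonalGL n` — `K`, the diagonal matrices
  with unit complex numbers on the diagonal; `one_mem_unitaryGL`, `unitDiagonalGL_subset_unitaryGL`.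
* `BCGPU2023_rem411_unitary : Prop` — the statement (existential in the two conjugators, as the tree's
  `BCGPU2023_thm410`), with the tree's `KTripleProductProperty` (Lemma 4.8) and `conjugateSet`.
* **`BCGPU2023_rem411_unitary_holds`** — PROVED with the witnesses of the printed proof of Thm. 4.10,
  `H₁ = D₁ U(n) D₁⁻¹`, `H₂ = D₂ U(n) D₂⁻¹`, `D₁ = diag(2^{−i})` (strictly decreasing positive),
  `D₂ = diag(2^{i})` (strictly increasing positive): if `a h₁ h₂ = 1` then `h₁ᴴ h₁ = (h₂⁻¹)ᴴ (h₂⁻¹)`,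
  and comparing the diagonal entries `∑ᵢ (xᵢ/x_k)² |Mᵢₖ|² ≤ 1 ≤ ∑ᵢ (yᵢ/y_k)² |Nᵢₖ|²` column by column
  (the printed upper-left-entry comparison iterated, exactly as in the tree's real proof
  `BCGPU2023_thm410_holds`) forces `M`, `N` diagonal with unit-modulus diagonal entries; then
  `h₁, h₂ ∈ K` and `a = (h₁h₂)⁻¹ = h₂ᴴ h₁ᴴ ∈ K`.

Not typed (recorded, not weakened): the QUATERNIONIC case `GL(n,ℍ)` / `Sp(n)` of the remark
(Mathlib has `ℍ[ℝ]` and matrices over it, but the general linear group over a non-commutative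
division ring with its conjugate-transpose calculus is not set up in the tree); and, as for Thm. 4.10,
the dimension count of Table 1 (`dim U(n) = n²`, `dim K = n`, `r(GL(n,ℂ)) = 2n`) is not a Lean
statement (no submanifold dimension).  TODO(general form): `GL(n,ℍ)` / `Sp(n)`.
-/

noncomputable section

open scoped BigOperators Matrix ComplexConjugate

namespace Literature.Computability.AlgebraicComplexity

/-! ## Statement -/

section UnitaryGroups

variable (n : ℕ)

/-- `U(n) = U(n,ℂ) ≤ GL(n,ℂ)`: the invertible complex matrices `g` with `gᴴ g = 1` ("replace transpose
with conjugate transpose"). [cite: BlasiakCohnGrochowPrattUmans2023, Rem. 4.11] -/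
def unitaryGL : Set (GL (Fin n) ℂ) :=
  {g | ((g : Matrix (Fin n) (Fin n) ℂ))ᴴ * (g : Matrix (Fin n) (Fin n) ℂ) = 1}

/-- `K ≤ GL(n,ℂ)`: "the group of diagonal matrices with unit complex numbers on the diagonal".
[cite: BlasiakCohnGrochowPrattUmans2023, Rem. 4.11] -/
def unitDiagonalGL : Set (GL (Fin n) ℂ) :=
  {g | ∀ j l : Fin n, (j ≠ l → (g : Matrix (Fin n) (Fin n) ℂ) j l = 0) ∧
    ‖(g : Matrix (Fin n) (Fin n) ℂ) j j‖ = 1}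

/-- `1 ∈ U(n)`. [cite: BlasiakCohnGrochowPrattUmans2023, Rem. 4.11] -/
theorem one_mem_unitaryGL : (1 : GL (Fin n) ℂ) ∈ unitaryGL n := by
  simp [unitaryGL]

/-- `K ⊆ U(n)`: a diagonal matrix with unit-modulus diagonal entries is unitary.
[cite: BlasiakCohnGrochowPrattUmans2023, Rem. 4.11] -/
theorem unitDiagonalGL_subset_unitaryGL : unitDiagonalGL n ⊆ unitaryGL n := by
  intro g hg
  simp only [unitDiagonalGL, Set.mem_setOf_eq] at hg
  simp only [unitaryGL, Set.mem_setOf_eq]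
  ext j l
  rw [Matrix.mul_apply, Finset.sum_eq_single j]
  · by_cases hjl : j = l
    · subst hjl
      rw [Matrix.conjTranspose_apply, Matrix.one_apply_eq, Complex.star_def, Complex.conj_mul',
        (hg j j).2]
      norm_num
    · rw [Matrix.conjTranspose_apply, (hg j l).1 hjl, mul_zero, Matrix.one_apply_ne hjl]
  · intro i _ hij
    rw [Matrix.conjTranspose_apply, (hg i j).1 hij, star_zero, zero_mul]
  · simp

/-- **Blasiak–Cohn–Grochow–Pratt–Umans 2023, Remark 4.11, complex case** ("This theorem [Thm. 4.10]
holds when we replace `G` with `GL(n,ℂ)` …, `H` with `U(n,ℂ)` …, and `K` with the group of diagonal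
matrices with unit complex … numbers on the diagonal"): there are three conjugates of `U(n)` inside
`GL(n,ℂ)` satisfying the `K`-triple product property (Lemma 4.8, the tree's `KTripleProductProperty`),
`K` = `unitDiagonalGL n`.  Existential in the conjugators, as the tree's `BCGPU2023_thm410`; PROVED
below (`BCGPU2023_rem411_unitary_holds`) with `H`, `D₁HD₁⁻¹`, `D₂HD₂⁻¹`, `D₁ = diag(2^{−i})`,
`D₂ = diag(2^{i})`. [cite: BlasiakCohnGrochowPrattUmans2023, Rem. 4.11] -/
def BCGPU2023_rem411_unitary : Prop :=
  ∀ n : ℕ, ∃ g₁ g₂ : GL (Fin n) ℂ,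
    KTripleProductProperty (unitaryGL n) (conjugateSet g₁ (unitaryGL n))
      (conjugateSet g₂ (unitaryGL n)) (unitDiagonalGL n)

end UnitaryGroups

/-! ## Proof ("a similar argument, where one replaces transpose with conjugate transpose and uses the
positivity of the complex norm") -/

section Rem411Proof

/-- Unit columns of a complex matrix `M` with `Mᴴ M = 1`: `∑ᵢ |Mᵢₖ|² = 1`. [folklore] -/
private theorem col_normSq_sum_eq_one {n : ℕ} {M : Matrix (Fin n) (Fin n) ℂ} (hM : Mᴴ * M = 1)
    (k : Fin n) : ∑ i, ‖M i k‖ ^ 2 = 1 := by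
  have h := congrFun (congrFun hM k) k
  rw [Matrix.mul_apply, Matrix.one_apply_eq] at h
  simp only [Matrix.conjTranspose_apply, Complex.star_def, Complex.conj_mul'] at h
  exact_mod_cast h

/-- Unit rows of a complex matrix `M` with `Mᴴ M = 1` (as `M Mᴴ = 1` too): `∑ᵢ |Mⱼᵢ|² = 1`.
[folklore] -/
private theorem row_normSq_sum_eq_one {n : ℕ} {M : Matrix (Fin n) (Fin n) ℂ} (hM : Mᴴ * M = 1)
    (j : Fin n) : ∑ i, ‖M j i‖ ^ 2 = 1 := by
  have hM' : M * Mᴴ = 1 := mul_eq_one_comm.1 hM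
  have h := congrFun (congrFun hM' j) j
  rw [Matrix.mul_apply, Matrix.one_apply_eq] at h
  simp only [Matrix.conjTranspose_apply, Complex.star_def, Complex.mul_conj'] at h
  exact_mod_cast h

/-- If column `j` of a unitary matrix vanishes off the diagonal, its diagonal entry has modulus `1`.
[folklore] -/
private theorem diag_normSq_eq_one_of_col {n : ℕ} {M : Matrix (Fin n) (Fin n) ℂ} (hM : Mᴴ * M = 1)
    {j : Fin n} (hcol : ∀ i, i ≠ j → M i j = 0) : ‖M j j‖ ^ 2 = 1 := by
  classical
  have h := col_normSq_sum_eq_one hM j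
  rw [← Finset.add_sum_erase _ _ (Finset.mem_univ j)] at h
  have h0 : ∑ i ∈ Finset.univ.erase j, ‖M i j‖ ^ 2 = 0 :=
    Finset.sum_eq_zero fun i hi => by rw [hcol i (Finset.ne_of_mem_erase hi), norm_zero,
      zero_pow two_ne_zero]
  linarith

/-- If column `j` of a unitary matrix is supported on the diagonal, then so is row `j` (the block form
of the printed proof). [cite: BlasiakCohnGrochowPrattUmans2023, Thm. 4.10 (proof) and Rem. 4.11] -/
private theorem row_eq_zero_of_col {n : ℕ} {M : Matrix (Fin n) (Fin n) ℂ} (hM : Mᴴ * M = 1)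
    {j : Fin n} (hcol : ∀ i, i ≠ j → M i j = 0) {k : Fin n} (hkj : k ≠ j) : M j k = 0 := by
  classical
  have hjj : ‖M j j‖ ^ 2 = 1 := diag_normSq_eq_one_of_col hM hcol
  have h := row_normSq_sum_eq_one hM j
  rw [← Finset.add_sum_erase _ _ (Finset.mem_univ j), hjj] at h
  have h0 : ∑ i ∈ Finset.univ.erase j, ‖M j i‖ ^ 2 = 0 := by linarith
  have hk := (Finset.sum_eq_zero_iff_of_nonneg fun i _ => sq_nonneg ‖M j i‖).1 h0 k
    (Finset.mem_erase.2 ⟨hkj, Finset.mem_univ k⟩)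
  by_contra hne
  have hpos : 0 < ‖M j k‖ ^ 2 := by positivity
  linarith

/-- **Core of the argument** (the printed proof of Thm. 4.10 with `|·|²` for `(·)²`). For unitary
`M, N`, strictly decreasing positive `x` and strictly increasing positive `y`: if for every `k`
`∑ᵢ (xᵢ/x_k)² |Mᵢₖ|² = ∑ᵢ (yᵢ/y_k)² |Nᵢₖ|²` (equality of the diagonal entries of
`(D_x M D_x⁻¹)ᴴ(D_x M D_x⁻¹)` and `(D_y N D_y⁻¹)ᴴ(D_y N D_y⁻¹)`), then `M` and `N` are diagonal with
unit-modulus diagonal entries (column induction: the left side is `≤ ∑ |Mᵢₖ|² = 1`, the right side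
`≥ 1`, with equality iff the entries below the diagonal vanish).
[cite: BlasiakCohnGrochowPrattUmans2023, Thm. 4.10 (proof) and Rem. 4.11] -/
private theorem unitDiag_of_diag_entries_eq {n : ℕ} (M N : Matrix (Fin n) (Fin n) ℂ)
    (hM : Mᴴ * M = 1) (hN : Nᴴ * N = 1) (x y : Fin n → ℝ) (hx0 : ∀ i, 0 < x i)
    (hx : StrictAnti x) (hy0 : ∀ i, 0 < y i) (hy : StrictMono y)
    (hPQ : ∀ k, ∑ i, (x i / x k) ^ 2 * ‖M i k‖ ^ 2 = ∑ i, (y i / y k) ^ 2 * ‖N i k‖ ^ 2)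
    (k : Fin n) :
    (∀ i, i ≠ k → M i k = 0 ∧ N i k = 0) ∧ ‖M k k‖ = 1 ∧ ‖N k k‖ = 1 := by
  classical
  have key : ∀ t : ℕ, ∀ k : Fin n, (k : ℕ) < t → ∀ i, i ≠ k → M i k = 0 ∧ N i k = 0 := by
    intro t
    induction t with
    | zero =>
      intro k hk
      exact absurd hk (Nat.not_lt_zero _)
    | succ t ih =>
      intro k hk
      by_cases hkt : (k : ℕ) < t
      · exact ih k hkt
      -- the earlier columns, hence the earlier rows, are supported on the diagonal
      have hcol : ∀ j : Fin n, j < k → ∀ i, i ≠ j → M i j = 0 ∧ N i j = 0 :=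
        fun j hj => ih j (by have := Fin.lt_def.1 hj; omega)
      have hrowM : ∀ j : Fin n, j < k → M j k = 0 := fun j hj =>
        row_eq_zero_of_col hM (fun i hi => ((hcol j hj) i hi).1) (ne_of_gt hj)
      have hrowN : ∀ j : Fin n, j < k → N j k = 0 := fun j hj =>
        row_eq_zero_of_col hN (fun i hi => ((hcol j hj) i hi).2) (ne_of_gt hj)
      -- termwise: `P_kk ≤ Σ_i |M_ik|² = 1` and `1 = Σ_i |N_ik|² ≤ Q_kk`
      have hPle : ∀ i, (x i / x k) ^ 2 * ‖M i k‖ ^ 2 ≤ ‖M i k‖ ^ 2 := by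
        intro i
        by_cases hik : i < k
        · rw [hrowM i hik]; simp
        · have hle : x i ≤ x k := hx.antitone (not_lt.1 hik)
          have hr1 : x i / x k ≤ 1 := (div_le_one (hx0 k)).2 hle
          have hr0 : 0 ≤ x i / x k := div_nonneg (hx0 i).le (hx0 k).le
          calc (x i / x k) ^ 2 * ‖M i k‖ ^ 2 ≤ 1 * ‖M i k‖ ^ 2 := by
                gcongr; exact pow_le_one₀ hr0 hr1
            _ = ‖M i k‖ ^ 2 := one_mul _
      have hQge : ∀ i, ‖N i k‖ ^ 2 ≤ (y i / y k) ^ 2 * ‖N i k‖ ^ 2 := by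
        intro i
        by_cases hik : i < k
        · rw [hrowN i hik]; simp
        · have hle : y k ≤ y i := hy.monotone (not_lt.1 hik)
          have hr1 : 1 ≤ y i / y k := (one_le_div (hy0 k)).2 hle
          calc ‖N i k‖ ^ 2 = 1 * ‖N i k‖ ^ 2 := (one_mul _).symm
            _ ≤ (y i / y k) ^ 2 * ‖N i k‖ ^ 2 := by gcongr; exact one_le_pow₀ hr1
      have hMc := col_normSq_sum_eq_one hM k
      have hNc := col_normSq_sum_eq_one hN k
      have hP : ∑ i, (x i / x k) ^ 2 * ‖M i k‖ ^ 2 = ∑ i, ‖M i k‖ ^ 2 := by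
        apply le_antisymm (Finset.sum_le_sum fun i _ => hPle i)
        rw [hMc, hPQ k, ← hNc]
        exact Finset.sum_le_sum fun i _ => hQge i
      have hQ : ∑ i, ‖N i k‖ ^ 2 = ∑ i, (y i / y k) ^ 2 * ‖N i k‖ ^ 2 := by
        apply le_antisymm (Finset.sum_le_sum fun i _ => hQge i)
        rw [← hPQ k, hNc, ← hMc]
        exact Finset.sum_le_sum fun i _ => hPle i
      have hPt := (Finset.sum_eq_sum_iff_of_le fun i _ => hPle i).1 hP
      have hQt := (Finset.sum_eq_sum_iff_of_le fun i _ => hQge i).1 hQ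
      intro i hik
      rcases lt_or_gt_of_ne hik with hlt | hgt
      · exact ⟨hrowM i hlt, hrowN i hlt⟩
      · -- `i > k`: the ratios are strict, so the entries vanish
        have hxlt : x i / x k < 1 := (div_lt_one (hx0 k)).2 (hx hgt)
        have hylt : 1 < y i / y k := (one_lt_div (hy0 k)).2 (hy hgt)
        have h1 := hPt i (Finset.mem_univ i)
        have h2 := hQt i (Finset.mem_univ i)
        have hx1 : (x i / x k) ^ 2 < 1 :=
          pow_lt_one₀ (div_nonneg (hx0 i).le (hx0 k).le) hxlt two_ne_zero
        have hy1 : 1 < (y i / y k) ^ 2 := one_lt_pow₀ hylt two_ne_zero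
        have hM0 : ‖M i k‖ ^ 2 = 0 := by nlinarith [sq_nonneg ‖M i k‖]
        have hN0 : ‖N i k‖ ^ 2 = 0 := by nlinarith [sq_nonneg ‖N i k‖]
        exact ⟨norm_eq_zero.1 ((pow_eq_zero_iff two_ne_zero).1 hM0),
          norm_eq_zero.1 ((pow_eq_zero_iff two_ne_zero).1 hN0)⟩
  have hk := key ((k : ℕ) + 1) k (Nat.lt_succ_self _)
  have sq1 : ∀ {r : ℝ}, 0 ≤ r → r ^ 2 = 1 → r = 1 := fun hr h => by
    nlinarith
  refine ⟨hk, ?_, ?_⟩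
  · exact sq1 (norm_nonneg _) (diag_normSq_eq_one_of_col hM fun i hi => (hk i hi).1)
  · exact sq1 (norm_nonneg _) (diag_normSq_eq_one_of_col hN fun i hi => (hk i hi).2)

/-- A diagonal matrix with unit-modulus diagonal satisfies `E Eᴴ = 1`. [folklore] -/
private theorem unitDiag_mul_conjTranspose_self {n : ℕ} {E : Matrix (Fin n) (Fin n) ℂ}
    (h : ∀ j l, (j ≠ l → E j l = 0) ∧ ‖E j j‖ = 1) : E * Eᴴ = 1 := by
  classical
  ext j l
  rw [Matrix.mul_apply, Finset.sum_eq_single j (fun i _ hi => by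
    rw [(h j i).1 (Ne.symm hi), zero_mul]) (fun hj => absurd (Finset.mem_univ j) hj)]
  by_cases hjl : j = l
  · subst hjl
    rw [Matrix.one_apply_eq, Matrix.conjTranspose_apply, Complex.star_def, Complex.mul_conj',
      (h j j).2]
    norm_num
  · rw [Matrix.conjTranspose_apply, (h l j).1 (Ne.symm hjl), star_zero, mul_zero,
      Matrix.one_apply_ne hjl]

/-- The conjugate transpose of a diagonal matrix with unit-modulus diagonal is again one. [folklore] -/
private theorem unitDiag_conjTranspose {n : ℕ} {E : Matrix (Fin n) (Fin n) ℂ}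
    (h : ∀ j l, (j ≠ l → E j l = 0) ∧ ‖E j j‖ = 1) :
    ∀ j l, (j ≠ l → Eᴴ j l = 0) ∧ ‖Eᴴ j j‖ = 1 := by
  intro j l
  refine ⟨fun hjl => ?_, ?_⟩
  · rw [Matrix.conjTranspose_apply, (h l j).1 (Ne.symm hjl), star_zero]
  · rw [Matrix.conjTranspose_apply, Complex.star_def, Complex.norm_conj, (h j j).2]

/-- The product of two diagonal matrices with unit-modulus diagonals is again one. [folklore] -/
private theorem unitDiag_mul {n : ℕ} {E F : Matrix (Fin n) (Fin n) ℂ}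
    (hE : ∀ j l, (j ≠ l → E j l = 0) ∧ ‖E j j‖ = 1)
    (hF : ∀ j l, (j ≠ l → F j l = 0) ∧ ‖F j j‖ = 1) :
    ∀ j l, (j ≠ l → (E * F) j l = 0) ∧ ‖(E * F) j j‖ = 1 := by
  classical
  intro j l
  have hent : ∀ l, (E * F) j l = E j j * F j l := fun l => by
    rw [Matrix.mul_apply, Finset.sum_eq_single j (fun i _ hi => by
      rw [(hE j i).1 (Ne.symm hi), zero_mul]) (fun hj => absurd (Finset.mem_univ j) hj)]
  refine ⟨fun hjl => by rw [hent, (hF j l).1 hjl, mul_zero], ?_⟩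
  rw [hent, norm_mul, (hE j j).2, (hF j j).2, one_mul]

/-- The modulus of a conjugated entry: `|xᵢ Mᵢₖ x_k⁻¹|² = (xᵢ/x_k)² |Mᵢₖ|²` for real positive `x`.
[folklore] -/
private theorem normSq_conj_entry {n : ℕ} (M : Matrix (Fin n) (Fin n) ℂ) {x : Fin n → ℝ}
    (hx0 : ∀ i, 0 < x i) (i k : Fin n) :
    ‖(x i : ℂ) * M i k * ((x k : ℂ))⁻¹‖ ^ 2 = (x i / x k) ^ 2 * ‖M i k‖ ^ 2 := by
  rw [norm_mul, norm_mul, norm_inv, Complex.norm_of_nonneg (hx0 i).le,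
    Complex.norm_of_nonneg (hx0 k).le, div_eq_mul_inv]
  ring

/-- The diagonal entries of `Bᴴ B`: `(Bᴴ B)_{kk} = ∑ᵢ |Bᵢₖ|²`. [folklore] -/
private theorem conjTranspose_mul_self_apply_diag {n : ℕ} (B : Matrix (Fin n) (Fin n) ℂ) (k : Fin n) :
    (Bᴴ * B) k k = ((∑ i, ‖B i k‖ ^ 2 : ℝ) : ℂ) := by
  rw [Matrix.mul_apply]
  push_cast
  refine Finset.sum_congr rfl fun i _ => ?_
  rw [Matrix.conjTranspose_apply, Complex.star_def, Complex.conj_mul']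

/-- **Blasiak–Cohn–Grochow–Pratt–Umans 2023, Remark 4.11 (complex case), proved**: with
`H = U(n)`, `H₁ = D₁HD₁⁻¹`, `H₂ = D₂HD₂⁻¹`, `D₁ = diag(2^{−i})`, `D₂ = diag(2^{i})`, if `a h₁ h₂ = 1`
with `a ∈ H`, `h₁ = D₁M₁D₁⁻¹`, `h₂ = D₂ND₂⁻¹`, then `h₁ᴴh₁ = (h₂⁻¹)ᴴ(h₂⁻¹)` with `h₂⁻¹ = D₂NᴴD₂⁻¹`,
and comparing diagonal entries (`unitDiag_of_diag_entries_eq`) shows `M₁`, `Nᴴ` are diagonal with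
unit-modulus diagonals; hence `h₁, h₂ ∈ K` and `a = h₂ᴴ h₁ᴴ ∈ K`.
[cite: BlasiakCohnGrochowPrattUmans2023, Rem. 4.11 and Thm. 4.10 (proof)] -/
theorem BCGPU2023_rem411_unitary_holds : BCGPU2023_rem411_unitary := by
  intro n
  classical
  -- the real diagonal conjugators, and their complexifications
  set x : Fin n → ℝ := fun i => ((2 : ℝ) ^ (i : ℕ))⁻¹ with hx
  set y : Fin n → ℝ := fun i => (2 : ℝ) ^ (i : ℕ) with hy
  have hx0 : ∀ i, 0 < x i := fun i => by positivity
  have hy0 : ∀ i, 0 < y i := fun i => by positivity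
  have hymono : StrictMono y := fun i j hij =>
    pow_lt_pow_right₀ (by norm_num : (1 : ℝ) < 2) (Fin.lt_def.1 hij)
  have hxanti : StrictAnti x := fun i j hij =>
    (inv_lt_inv₀ (hy0 j) (hy0 i)).2 (hymono hij)
  set xc : Fin n → ℂ := fun i => (x i : ℂ) with hxc
  set yc : Fin n → ℂ := fun i => (y i : ℂ) with hyc
  have hxc0 : ∀ i, xc i ≠ 0 := fun i => Complex.ofReal_ne_zero.2 (hx0 i).ne'
  have hyc0 : ∀ i, yc i ≠ 0 := fun i => Complex.ofReal_ne_zero.2 (hy0 i).ne'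
  have hdx : Matrix.diagonal xc * Matrix.diagonal (fun i => (xc i)⁻¹) = 1 := by
    rw [Matrix.diagonal_mul_diagonal, ← Matrix.diagonal_one]
    congr 1
    funext i
    exact mul_inv_cancel₀ (hxc0 i)
  have hdx' : Matrix.diagonal (fun i => (xc i)⁻¹) * Matrix.diagonal xc = 1 := by
    rw [Matrix.diagonal_mul_diagonal, ← Matrix.diagonal_one]
    congr 1
    funext i
    exact inv_mul_cancel₀ (hxc0 i)
  have hdy : Matrix.diagonal yc * Matrix.diagonal (fun i => (yc i)⁻¹) = 1 := by
    rw [Matrix.diagonal_mul_diagonal, ← Matrix.diagonal_one]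
    congr 1
    funext i
    exact mul_inv_cancel₀ (hyc0 i)
  have hdy' : Matrix.diagonal (fun i => (yc i)⁻¹) * Matrix.diagonal yc = 1 := by
    rw [Matrix.diagonal_mul_diagonal, ← Matrix.diagonal_one]
    congr 1
    funext i
    exact inv_mul_cancel₀ (hyc0 i)
  set g₁ : GL (Fin n) ℂ := ⟨Matrix.diagonal xc, Matrix.diagonal fun i => (xc i)⁻¹, hdx, hdx'⟩ with hg₁
  set g₂ : GL (Fin n) ℂ := ⟨Matrix.diagonal yc, Matrix.diagonal fun i => (yc i)⁻¹, hdy, hdy'⟩ with hg₂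
  have hg₁v : ((g₁ : GL (Fin n) ℂ) : Matrix (Fin n) (Fin n) ℂ) = Matrix.diagonal xc := rfl
  have hg₁i : ((g₁⁻¹ : GL (Fin n) ℂ) : Matrix (Fin n) (Fin n) ℂ) = Matrix.diagonal fun i => (xc i)⁻¹ :=
    rfl
  have hg₂v : ((g₂ : GL (Fin n) ℂ) : Matrix (Fin n) (Fin n) ℂ) = Matrix.diagonal yc := rfl
  have hg₂i : ((g₂⁻¹ : GL (Fin n) ℂ) : Matrix (Fin n) (Fin n) ℂ) = Matrix.diagonal fun i => (yc i)⁻¹ :=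
    rfl
  refine ⟨g₁, g₂, ?_⟩
  rintro a ha _ ⟨M₁, hM₁, rfl⟩ _ ⟨N, hN, rfl⟩ habc
  have habc' : a * (g₁ * M₁ * g₁⁻¹) * (g₂ * N * g₂⁻¹) = 1 := habc
  have ha' : ((a : GL (Fin n) ℂ) : Matrix (Fin n) (Fin n) ℂ)ᴴ * (a : Matrix (Fin n) (Fin n) ℂ) = 1 := ha
  have hM₁' : ((M₁ : GL (Fin n) ℂ) : Matrix (Fin n) (Fin n) ℂ)ᴴ * (M₁ : Matrix (Fin n) (Fin n) ℂ) = 1 :=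
    hM₁
  have hN' : ((N : GL (Fin n) ℂ) : Matrix (Fin n) (Fin n) ℂ)ᴴ * (N : Matrix (Fin n) (Fin n) ℂ) = 1 := hN
  -- the matrix of `N⁻¹` is `Nᴴ`
  have hNinv : ((N⁻¹ : GL (Fin n) ℂ) : Matrix (Fin n) (Fin n) ℂ) = (N : Matrix (Fin n) (Fin n) ℂ)ᴴ := by
    have h1 : ((N⁻¹ : GL (Fin n) ℂ) : Matrix (Fin n) (Fin n) ℂ) * (N : Matrix (Fin n) (Fin n) ℂ) = 1 := by
      rw [← Units.val_mul, inv_mul_cancel, Units.val_one]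
    have h2 : (N : Matrix (Fin n) (Fin n) ℂ) * (N : Matrix (Fin n) (Fin n) ℂ)ᴴ = 1 :=
      mul_eq_one_comm.1 hN'
    calc ((N⁻¹ : GL (Fin n) ℂ) : Matrix (Fin n) (Fin n) ℂ)
        = (N⁻¹ : GL (Fin n) ℂ) * ((N : Matrix (Fin n) (Fin n) ℂ) * (N : Matrix (Fin n) (Fin n) ℂ)ᴴ) := by
          rw [h2, Matrix.mul_one]
      _ = (N : Matrix (Fin n) (Fin n) ℂ)ᴴ := by rw [← Matrix.mul_assoc, h1, Matrix.one_mul]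
  -- matrices of `h₁ = g₁ M₁ g₁⁻¹`, `h₂ = g₂ N g₂⁻¹` and `h₂⁻¹ = g₂ N⁻¹ g₂⁻¹`
  set B := Matrix.diagonal xc * (M₁ : Matrix (Fin n) (Fin n) ℂ) * Matrix.diagonal (fun i => (xc i)⁻¹)
    with hB
  set Cm := Matrix.diagonal yc * (N : Matrix (Fin n) (Fin n) ℂ) * Matrix.diagonal (fun i => (yc i)⁻¹)
    with hCm
  set C' := Matrix.diagonal yc * (N : Matrix (Fin n) (Fin n) ℂ)ᴴ * Matrix.diagonal (fun i => (yc i)⁻¹)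
    with hC'
  have hbm : ((g₁ * M₁ * g₁⁻¹ : GL (Fin n) ℂ) : Matrix (Fin n) (Fin n) ℂ) = B := by
    rw [Units.val_mul, Units.val_mul, hg₁v, hg₁i]
  have hcm : ((g₂ * N * g₂⁻¹ : GL (Fin n) ℂ) : Matrix (Fin n) (Fin n) ℂ) = Cm := by
    rw [Units.val_mul, Units.val_mul, hg₂v, hg₂i]
  have hcm' : ((g₂ * N⁻¹ * g₂⁻¹ : GL (Fin n) ℂ) : Matrix (Fin n) (Fin n) ℂ) = C' := by
    rw [Units.val_mul, Units.val_mul, hg₂v, hg₂i, hNinv]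
  have hBentry : ∀ i k, B i k = xc i * (M₁ : Matrix (Fin n) (Fin n) ℂ) i k * (xc k)⁻¹ := by
    intro i k
    rw [hB, Matrix.mul_diagonal, Matrix.diagonal_mul]
  have hCmentry : ∀ i k, Cm i k = yc i * (N : Matrix (Fin n) (Fin n) ℂ) i k * (yc k)⁻¹ := by
    intro i k
    rw [hCm, Matrix.mul_diagonal, Matrix.diagonal_mul]
  have hC'entry : ∀ i k, C' i k = yc i * (N : Matrix (Fin n) (Fin n) ℂ)ᴴ i k * (yc k)⁻¹ := by
    intro i k
    rw [hC', Matrix.mul_diagonal, Matrix.diagonal_mul]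
  -- `a h₁ = h₂⁻¹`, so `h₁ᴴ h₁ = (h₂⁻¹)ᴴ (h₂⁻¹)`
  have hab : a * (g₁ * M₁ * g₁⁻¹) = g₂ * N⁻¹ * g₂⁻¹ := by
    rw [eq_inv_of_mul_eq_one_left habc']
    simp only [mul_inv_rev, inv_inv, mul_assoc]
  have hAB : (a : Matrix (Fin n) (Fin n) ℂ) * B = C' := by
    have h := congrArg (fun g : GL (Fin n) ℂ => (g : Matrix (Fin n) (Fin n) ℂ)) hab
    rw [Units.val_mul, hbm, hcm'] at h
    exact h
  have hBB : Bᴴ * B = C'ᴴ * C' := by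
    calc Bᴴ * B = Bᴴ * (((a : GL (Fin n) ℂ) : Matrix (Fin n) (Fin n) ℂ)ᴴ *
          (a : Matrix (Fin n) (Fin n) ℂ)) * B := by rw [ha', Matrix.mul_one]
      _ = ((a : Matrix (Fin n) (Fin n) ℂ) * B)ᴴ * ((a : Matrix (Fin n) (Fin n) ℂ) * B) := by
          rw [Matrix.conjTranspose_mul (a : Matrix (Fin n) (Fin n) ℂ) B]; simp only [Matrix.mul_assoc]
      _ = C'ᴴ * C' := by rw [hAB]
  have hPQ : ∀ k, ∑ i, (x i / x k) ^ 2 * ‖(M₁ : Matrix (Fin n) (Fin n) ℂ) i k‖ ^ 2 =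
      ∑ i, (y i / y k) ^ 2 * ‖(N : Matrix (Fin n) (Fin n) ℂ)ᴴ i k‖ ^ 2 := by
    intro k
    have h := congrFun (congrFun hBB k) k
    rw [conjTranspose_mul_self_apply_diag, conjTranspose_mul_self_apply_diag] at h
    have h' : ∑ i, ‖B i k‖ ^ 2 = ∑ i, ‖C' i k‖ ^ 2 := by exact_mod_cast h
    simp only [hBentry, hC'entry, hxc, hyc, normSq_conj_entry _ hx0, normSq_conj_entry _ hy0] at h'
    exact h'
  -- the core lemma: `M₁` and `Nᴴ` are diagonal with unit-modulus diagonals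
  have hNt : ((N : Matrix (Fin n) (Fin n) ℂ)ᴴ)ᴴ * (N : Matrix (Fin n) (Fin n) ℂ)ᴴ = 1 := by
    rw [Matrix.conjTranspose_conjTranspose]; exact mul_eq_one_comm.1 hN'
  have core := unitDiag_of_diag_entries_eq _ _ hM₁' hNt x y hx0 hxanti hy0 hymono hPQ
  -- `h₁ ∈ K` and `h₂ ∈ K`
  have hBK : ∀ j l, (j ≠ l → B j l = 0) ∧ ‖B j j‖ = 1 := by
    intro j l
    refine ⟨fun hjl => ?_, ?_⟩
    · rw [hBentry, ((core l).1 j hjl).1, mul_zero, zero_mul]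
    · rw [hBentry, mul_assoc, mul_comm ((M₁ : Matrix (Fin n) (Fin n) ℂ) j j), ← mul_assoc,
        mul_inv_cancel₀ (hxc0 j), one_mul]
      exact (core j).2.1
  have hCK : ∀ j l, (j ≠ l → Cm j l = 0) ∧ ‖Cm j j‖ = 1 := by
    intro j l
    refine ⟨fun hjl => ?_, ?_⟩
    · have h0 : (N : Matrix (Fin n) (Fin n) ℂ) j l = 0 := by
        have h := ((core j).1 l (Ne.symm hjl)).2
        rw [Matrix.conjTranspose_apply] at h
        simpa using h
      rw [hCmentry, h0, mul_zero, zero_mul]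
    · rw [hCmentry, mul_assoc, mul_comm ((N : Matrix (Fin n) (Fin n) ℂ) j j), ← mul_assoc,
        mul_inv_cancel₀ (hyc0 j), one_mul]
      have h := (core j).2.2
      rwa [Matrix.conjTranspose_apply, Complex.star_def, Complex.norm_conj] at h
  -- `a = (h₁ h₂)⁻¹ = h₂ᴴ h₁ᴴ`
  have habcm : (a : Matrix (Fin n) (Fin n) ℂ) * B * Cm = 1 := by
    have h := congrArg (fun g : GL (Fin n) ℂ => (g : Matrix (Fin n) (Fin n) ℂ)) habc'
    rw [Units.val_mul, Units.val_mul, hbm, hcm, Units.val_one] at h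
    exact h
  have haCB : (a : Matrix (Fin n) (Fin n) ℂ) = Cmᴴ * Bᴴ := by
    calc (a : Matrix (Fin n) (Fin n) ℂ)
        = (a : Matrix (Fin n) (Fin n) ℂ) * (B * (Cm * Cmᴴ) * Bᴴ) := by
          rw [unitDiag_mul_conjTranspose_self hCK, Matrix.mul_one,
            unitDiag_mul_conjTranspose_self hBK, Matrix.mul_one]
      _ = (a : Matrix (Fin n) (Fin n) ℂ) * B * Cm * (Cmᴴ * Bᴴ) := by simp only [Matrix.mul_assoc]
      _ = Cmᴴ * Bᴴ := by rw [habcm, Matrix.one_mul]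
  refine ⟨?_, ?_, ?_⟩
  · show ∀ j l : Fin n, (j ≠ l → (a : Matrix (Fin n) (Fin n) ℂ) j l = 0) ∧
      ‖(a : Matrix (Fin n) (Fin n) ℂ) j j‖ = 1
    rw [haCB]
    exact unitDiag_mul (unitDiag_conjTranspose hCK) (unitDiag_conjTranspose hBK)
  · show ∀ j l : Fin n, (j ≠ l → ((g₁ * M₁ * g₁⁻¹ : GL (Fin n) ℂ) : Matrix (Fin n) (Fin n) ℂ) j l = 0) ∧
      ‖((g₁ * M₁ * g₁⁻¹ : GL (Fin n) ℂ) : Matrix (Fin n) (Fin n) ℂ) j j‖ = 1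
    rw [hbm]
    exact hBK
  · show ∀ j l : Fin n, (j ≠ l → ((g₂ * N * g₂⁻¹ : GL (Fin n) ℂ) : Matrix (Fin n) (Fin n) ℂ) j l = 0) ∧
      ‖((g₂ * N * g₂⁻¹ : GL (Fin n) ℂ) : Matrix (Fin n) (Fin n) ℂ) j j‖ = 1
    rw [hcm]
    exact hCK

end Rem411Proof

end Literature.Computability.AlgebraicComplexity

end
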